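import Summits.QuantumFields.BalabanUV.Beta.CovariantKato

/-!
# `Summit.QuantumFields.BalabanUV.Beta.CovariantLaplacianFlatSplit` — THE EXACT «COVARIANT = FLAT + FIRST ORDER + FLUX» SPLIT OF THE
# LATTICE LAPLACIAN `D_R*D_R` FOR ORTHOGONAL BOND MATRICES, AND ITS FIBRE-NORM BOUND (generic bond structure; module 1 of road P3's
# reduction «rough-`Rm` gradient member ⇐ flat interior estimate (FG) + sup member + ONE (3.35)-shaped binder (SF)», claim
# «COVARIANT-FLAT-SPLIT»)

HONEST FRAMING (page 1 of everything in this cell).  Discharging `FlowStep.BetaPertH` would make Bałaban's ultraviolet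
stability UNCONDITIONAL — a constructive-QFT result; it is NOT the continuum limit and NOT the Clay problem.  This module
discharges nothing of `BetaPertH`; it is [folklore] finite-dimensional algebra, kernel-checked, by CO-OWNER #3 of binder row D4 (unit
`b2b-balaban-beta-d4-p3`, road P3 «reduction road», gen 13).  HONEST DEPENDENCY: continuum YM on T⁴ ⇐ BetaPertH ∧ nine spine estimates
(0/9 proved); BetaPertH ⇐ (D1) ∧ (D4) ∧ CAP+tail; G-an2-4 gates asym, D1 and NE2/3/4.

THE POINT.  O.2 item (i) of row D4's MODEL programme — the GRADIENT member (3.42)₂'s SHAPE of [B9] Thm 3.1 — is being closed for the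
FLAT transport (`Rm ≡ 1`: co-owner beta-d4-p2's GR1–GR3, the owner's file 19) where translation invariance does the work.  For ROUGH
(arbitrary column-orthonormal) bond matrices the pointwise gradient member is NOT level-free without a small-field input — print's (3.35).
Road P3's reduction isolates that input as ONE binder by PERTURBING AROUND THE FLAT OPERATOR IN A GOOD GAUGE.  THIS FILE is the algebraic
heart, on any finite bond structure `src, tgt : Bd → St` with weights `c` and bond matrices `Rm` with `RᵀR = 1` (hence `RRᵀ = 1`), next to a
FLAT family `Rm₀ ≡ δ`:
* §1 `sum_sub_delta_mul`, `sum_sub_delta_mul'` (bookkeeping of `(R − 1)v`, `(Rᵀ − 1)v`), **`covD_flat_split`**: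
  `(D_R f)(b,i) = (D_1 f)(b,i) + c_b·((R_b − 1)f(b₊))_i`;
* §2 **`covLap_flat_split`** — THE EXACT IDENTITY (no quadratic remainder):
  `(D_R*D_R f)(x,i) = (D_1*D_1 f)(x,i) + Σ_{b : tgt b = x} c_b·((R_b − 1)ᵀ(D_R f)(b))_i + Σ_{b : src b = x} c_b·((R_b − 1)ᵀ(D_R f)(b))_i
   + (M_R(x) f(x))_i`,  `M_R(x) := Σ_{b : tgt b = x} c_b²·(R_b − 1) + Σ_{b : src b = x} c_b²·(R_bᵀ − 1)` (the NET FLUX of `R − 1` at `x`)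
  — FIRST order in the COVARIANT derivative with coefficient `R_b − 1`, ZEROTH order only through the flux.  In a gauge `R = e^{iηA}` near `1`:
  `R_b − 1 ≈ iηA(b)` is (3.35)'s `|A| ≤ O(1)Mα₀(L^jη)^{−1}` and `M_R(x) ≈ −iη²c₀²(∇·A)(x) + O(η²A²)` is (3.35)'s `|∇A| ≤ O(1)Mα₀(L^jη)^{−2}`:
  the termwise bound `Σ_b c_b²‖R_b − 1‖` would LOSE one power of the scale, the flux keeps it;
* §3 `normT_sub_delta_le` (`‖(R_bᵀ − 1)v‖ ≤ ε_b‖v‖` from `‖(R_b − 1)v‖ ≤ ε_b‖v‖`, since `(Rᵀ − 1)v = −Rᵀ(R − 1)v`), and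
  **`norm_covLap_sub_flat_le`** — THE FIBRE-NORM BOUND: if `‖(R_b − 1)v‖ ≤ ε_b‖v‖` for the bonds at `x` and `‖M_R(x)v‖ ≤ ε_M‖v‖`, then
  `‖(D_R*D_R f − D_1*D_1 f)(x)‖ ≤ Σ_{b : tgt b = x} |c_b|ε_b‖(D_R f)(b)‖ + Σ_{b : src b = x} |c_b|ε_b‖(D_R f)(b)‖ + ε_M·‖f(x)‖`
  (`‖v‖ = √(Σ_i v_i²)` the fibre norm, as in file 12).
CONSUMER (the covariant assembly, after the owner's file 19 `MultiscaleGradientMember` lands, in its letters): at a bond `b` of local scale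
`n`, in the (SF) gauge on the ball of radius `R ≍ θn` one has `ε_b ≤ σ₁/(R+1)`, `ε_M ≤ σ₂c₀²/(R+1)²`; the flat interior estimate (FG) with
source `u − levelSum f − (D_R*D_R − D_1*D_1)f`, the CLOSED sup member (file 17) and a scale bootstrap give the gradient member with ONE power
of the scale iff `σ₁` is small — print's «Mα₀ ≤ a₀».  Module 2 (`CovariantLaplacianGauge`) supplies the gauge covariance.

LOCATORS (shape only, nothing printed asserted; ABSOLUTE RULE): [Balaban1985BackgroundPropagators] (3.3) pp. 390–391, (3.23) p. 394
(`Δ_U = D_U*D_U`), (3.35) p. 396 (the regularity condition), Thm 3.1 (3.42) p. 397; [Balaban1983RegularityDecay] Lemma 2.2 pp. 577–578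
(print's own perturbation-in-the-background-field device — NOT reproduced).  Row D4: NO class change (critical-path width 0; D4 DISCHARGE
NO DATE); NOT BetaPertH, NOT continuum, NOT Clay, NOT summit progress.
-/

open scoped BigOperators
open Finset

namespace Summit.QuantumFields.BalabanUV.Beta.CovariantLaplacianFlatSplit

open Literature.MathematicalPhysics.QuantumFieldTheory.Balaban1983to89
open Literature.MathematicalPhysics.QuantumFieldTheory.Balaban1983to89.B9Thm37Glue (covD covDT covD_apply covDT_apply)
open Summit.QuantumFields.BalabanUV.Beta.CovariantKato (covLap_apply_split col_orth_apply row_orth_of_col_orth sqrt_sum_sq_add_le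
  sqrt_sum_sq_sum_le sqrt_sum_sq_smul sqrt_sum_sq_RmT)

noncomputable section

/-! ## §1 Bookkeeping of `R − 1` and the split of the covariant derivative -/

section Delta

variable {Cp : Type} [Fintype Cp] [DecidableEq Cp]

/-- `Σ_k (R_{ki} − δ_{ki})·g_k = Σ_k R_{ki}g_k − g_i` (the transpose action of `R − 1`). [folklore] -/
theorem sum_sub_delta_mul (Rm : Cp → Cp → ℝ) (g : Cp → ℝ) (i : Cp) :
    ∑ k, (Rm k i - if k = i then (1 : ℝ) else 0) * g k = ∑ k, Rm k i * g k - g i := by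
  simp only [sub_mul, Finset.sum_sub_distrib, ite_mul, one_mul, zero_mul, Finset.sum_ite_eq', Finset.mem_univ, if_true]

/-- `Σ_j (R_{ij} − δ_{ij})·g_j = Σ_j R_{ij}g_j − g_i` (the action of `R − 1`). [folklore] -/
theorem sum_sub_delta_mul' (Rm : Cp → Cp → ℝ) (g : Cp → ℝ) (i : Cp) :
    ∑ j, (Rm i j - if i = j then (1 : ℝ) else 0) * g j = ∑ j, Rm i j * g j - g i := by
  simp only [sub_mul, Finset.sum_sub_distrib, ite_mul, one_mul, zero_mul, Finset.sum_ite_eq, Finset.mem_univ, if_true]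

/-- For column-orthonormal `R`: `(Rᵀ − 1)v = −Rᵀ((R − 1)v)`, componentwise. [folklore] -/
theorem sumT_sub_delta_eq_neg (Rm : Cp → Cp → ℝ) (hRm : ∀ i j, ∑ k, Rm k i * Rm k j = if i = j then (1 : ℝ) else 0)
    (v : Cp → ℝ) (i : Cp) :
    ∑ k, (Rm k i - if k = i then (1 : ℝ) else 0) * v k = -∑ k, Rm k i * ∑ j, (Rm k j - if k = j then (1 : ℝ) else 0) * v j := by
  have h : ∀ k, ∑ j, (Rm k j - if k = j then (1 : ℝ) else 0) * v j = ∑ j, Rm k j * v j - v k :=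
    fun k => sum_sub_delta_mul' Rm v k
  simp only [h, mul_sub, Finset.sum_sub_distrib]
  rw [col_orth_apply Rm hRm v i, sum_sub_delta_mul Rm v i]
  ring

/-- A flat family is column-orthonormal. [folklore] -/
theorem flat_col_orth {Bd : Type} (Rm₀ : Bd → Cp → Cp → ℝ) (hflat : ∀ b i j, Rm₀ b i j = if i = j then (1 : ℝ) else 0)
    (b : Bd) (i j : Cp) : ∑ k, Rm₀ b k i * Rm₀ b k j = if i = j then (1 : ℝ) else 0 := by
  simp only [hflat]
  by_cases hij : i = j
  · subst hij
    simp [Finset.sum_ite_eq', Finset.mem_univ]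
  · rw [if_neg hij]
    refine Finset.sum_eq_zero fun k _ => ?_
    by_cases hki : k = i
    · subst hki; simp [hij]
    · simp [hki]

end Delta

section Split

variable {St Bd Cp : Type} [Fintype Bd] [Fintype Cp] [DecidableEq St] [DecidableEq Cp]
  (src tgt : Bd → St) (c : Bd → ℝ) (Rm Rm₀ : Bd → Cp → Cp → ℝ)

omit [Fintype Bd] [DecidableEq St] in
/-- **`D_R = D_1 + c·(R − 1)τ`**: `(D_R f)(b,i) = (D_1 f)(b,i) + c_b·Σ_j (R_b − 1)_{ij} f(b₊, j)` for a flat `Rm₀ ≡ δ`. [folklore] -/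
theorem covD_flat_split (hflat : ∀ b i j, Rm₀ b i j = if i = j then (1 : ℝ) else 0) (f : St × Cp → ℝ) (b : Bd) (i : Cp) :
    covD src tgt c Rm f (b, i) =
      covD src tgt c Rm₀ f (b, i) + c b * ∑ j, (Rm b i j - if i = j then (1 : ℝ) else 0) * f (tgt b, j) := by
  simp only [covD_apply]
  rw [sum_sub_delta_mul' (Rm b) (fun j => f (tgt b, j)) i]
  have h0 : ∑ j, Rm₀ b i j * f (tgt b, j) = f (tgt b, i) := by
    simp only [hflat, ite_mul, one_mul, zero_mul, Finset.sum_ite_eq, Finset.mem_univ, if_true]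
  rw [h0]
  ring

/-! ## §2 The exact split of the Laplacian -/

omit [Fintype Bd] [DecidableEq St] in
/-- Per target bond (`tgt b = x`): `−c_b²·(R_bᵀ f(b₋))_i + c_b²·f(b₋,i) = c_b·((R_b − 1)ᵀ(D_R f)(b))_i + c_b²·((R_b − 1)f(x))_i`. [folklore] -/
theorem tgt_bond_identity (hRm : ∀ b i j, ∑ k, Rm b k i * Rm b k j = if i = j then (1 : ℝ) else 0) (f : St × Cp → ℝ)
    (x : St) (i : Cp) (b : Bd) (hb : tgt b = x) :
    -(c b ^ 2 * ∑ k, Rm b k i * f (src b, k)) + c b ^ 2 * f (src b, i) =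
      c b * ∑ k, (Rm b k i - if k = i then (1 : ℝ) else 0) * covD src tgt c Rm f (b, k) +
        c b ^ 2 * ∑ j, (Rm b i j - if i = j then (1 : ℝ) else 0) * f (x, j) := by
  rw [sum_sub_delta_mul (Rm b) (fun k => covD src tgt c Rm f (b, k)) i, sum_sub_delta_mul' (Rm b) (fun j => f (x, j)) i]
  simp only [covD_apply, hb]
  have h1 : ∑ k, Rm b k i * (c b * (∑ j, Rm b k j * f (x, j) - f (src b, k))) =
      c b * (∑ k, Rm b k i * ∑ j, Rm b k j * f (x, j)) - c b * ∑ k, Rm b k i * f (src b, k) := by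
    rw [Finset.mul_sum, Finset.mul_sum, ← Finset.sum_sub_distrib]
    exact Finset.sum_congr rfl fun k _ => by ring
  rw [h1, col_orth_apply (Rm b) (hRm b) (fun j => f (x, j)) i]
  ring

omit [Fintype Bd] [DecidableEq St] in
/-- Per source bond (`src b = x`): `−c_b²·(R_b f(b₊))_i + c_b²·f(b₊,i) = c_b·((R_b − 1)ᵀ(D_R f)(b))_i + c_b²·((R_bᵀ − 1)f(x))_i`. [folklore] -/
theorem src_bond_identity (hRm : ∀ b i j, ∑ k, Rm b k i * Rm b k j = if i = j then (1 : ℝ) else 0) (f : St × Cp → ℝ)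
    (x : St) (i : Cp) (b : Bd) (hb : src b = x) :
    -(c b ^ 2 * ∑ j, Rm b i j * f (tgt b, j)) + c b ^ 2 * f (tgt b, i) =
      c b * ∑ k, (Rm b k i - if k = i then (1 : ℝ) else 0) * covD src tgt c Rm f (b, k) +
        c b ^ 2 * ∑ k, (Rm b k i - if k = i then (1 : ℝ) else 0) * f (x, k) := by
  rw [sum_sub_delta_mul (Rm b) (fun k => covD src tgt c Rm f (b, k)) i, sum_sub_delta_mul (Rm b) (fun k => f (x, k)) i]
  simp only [covD_apply, hb]
  have h1 : ∑ k, Rm b k i * (c b * (∑ j, Rm b k j * f (tgt b, j) - f (x, k))) =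
      c b * (∑ k, Rm b k i * ∑ j, Rm b k j * f (tgt b, j)) - c b * ∑ k, Rm b k i * f (x, k) := by
    rw [Finset.mul_sum, Finset.mul_sum, ← Finset.sum_sub_distrib]
    exact Finset.sum_congr rfl fun k _ => by ring
  rw [h1, col_orth_apply (Rm b) (hRm b) (fun j => f (tgt b, j)) i]
  ring

/-- **THE EXACT SPLIT `D_R*D_R = D_1*D_1 + (first order in D_R, coefficient R − 1) + (net flux of R − 1)`.**  For column-orthonormal bond
matrices `Rm` and a flat family `Rm₀ ≡ δ`, every field `f`, site `x` and component `i`: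
`(D_R*D_R f)(x,i) = (D_1*D_1 f)(x,i) + Σ_{b : tgt b = x} c_b·Σ_k (R_b − 1)_{ki}(D_R f)(b,k) + Σ_{b : src b = x} c_b·Σ_k (R_b − 1)_{ki}(D_R f)(b,k)
  + (Σ_{b : tgt b = x} c_b²·Σ_j (R_b − 1)_{ij} f(x,j) + Σ_{b : src b = x} c_b²·Σ_k (R_b − 1)_{ki} f(x,k))`
(file 12's `covLap_apply_split` for `Rm` and for `Rm₀`, then `tgt_bond_identity` ∕ `src_bond_identity` bond by bond).
[cite: Balaban1985BackgroundPropagators, (3.23) p.394 + (3.35) p.396] [folklore] -/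
theorem covLap_flat_split (hRm : ∀ b i j, ∑ k, Rm b k i * Rm b k j = if i = j then (1 : ℝ) else 0)
    (hflat : ∀ b i j, Rm₀ b i j = if i = j then (1 : ℝ) else 0) (f : St × Cp → ℝ) (x : St) (i : Cp) :
    covDT src tgt c Rm (covD src tgt c Rm f) (x, i) =
      covDT src tgt c Rm₀ (covD src tgt c Rm₀ f) (x, i)
      + ∑ b ∈ univ.filter (fun b => tgt b = x), c b * ∑ k, (Rm b k i - if k = i then (1 : ℝ) else 0) * covD src tgt c Rm f (b, k)
      + ∑ b ∈ univ.filter (fun b => src b = x), c b * ∑ k, (Rm b k i - if k = i then (1 : ℝ) else 0) * covD src tgt c Rm f (b, k)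
      + (∑ b ∈ univ.filter (fun b => tgt b = x), c b ^ 2 * ∑ j, (Rm b i j - if i = j then (1 : ℝ) else 0) * f (x, j)
        + ∑ b ∈ univ.filter (fun b => src b = x), c b ^ 2 * ∑ k, (Rm b k i - if k = i then (1 : ℝ) else 0) * f (x, k)) := by
  rw [covLap_apply_split src tgt c Rm hRm f x i, covLap_apply_split src tgt c Rm₀ (flat_col_orth Rm₀ hflat) f x i]
  -- the flat transported terms
  have hT0 : ∑ b ∈ univ.filter (fun b => tgt b = x), c b ^ 2 * ∑ k, Rm₀ b k i * f (src b, k) =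
      ∑ b ∈ univ.filter (fun b => tgt b = x), c b ^ 2 * f (src b, i) := by
    refine Finset.sum_congr rfl fun b _ => ?_
    congr 1
    simp only [hflat, ite_mul, one_mul, zero_mul, Finset.sum_ite_eq', Finset.mem_univ, if_true]
  have hS0 : ∑ b ∈ univ.filter (fun b => src b = x), c b ^ 2 * ∑ j, Rm₀ b i j * f (tgt b, j) =
      ∑ b ∈ univ.filter (fun b => src b = x), c b ^ 2 * f (tgt b, i) := by
    refine Finset.sum_congr rfl fun b _ => ?_
    congr 1
    simp only [hflat, ite_mul, one_mul, zero_mul, Finset.sum_ite_eq, Finset.mem_univ, if_true]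
  rw [hT0, hS0]
  -- the bond-by-bond identities, summed
  have hT : ∑ b ∈ univ.filter (fun b => tgt b = x), c b * ∑ k, (Rm b k i - if k = i then (1 : ℝ) else 0) * covD src tgt c Rm f (b, k)
      + ∑ b ∈ univ.filter (fun b => tgt b = x), c b ^ 2 * ∑ j, (Rm b i j - if i = j then (1 : ℝ) else 0) * f (x, j) =
      -(∑ b ∈ univ.filter (fun b => tgt b = x), c b ^ 2 * ∑ k, Rm b k i * f (src b, k))
        + ∑ b ∈ univ.filter (fun b => tgt b = x), c b ^ 2 * f (src b, i) := by
    rw [← Finset.sum_add_distrib, ← Finset.sum_neg_distrib, ← Finset.sum_add_distrib]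
    exact Finset.sum_congr rfl fun b hb => (tgt_bond_identity src tgt c Rm hRm f x i b (Finset.mem_filter.mp hb).2).symm
  have hS : ∑ b ∈ univ.filter (fun b => src b = x), c b * ∑ k, (Rm b k i - if k = i then (1 : ℝ) else 0) * covD src tgt c Rm f (b, k)
      + ∑ b ∈ univ.filter (fun b => src b = x), c b ^ 2 * ∑ k, (Rm b k i - if k = i then (1 : ℝ) else 0) * f (x, k) =
      -(∑ b ∈ univ.filter (fun b => src b = x), c b ^ 2 * ∑ j, Rm b i j * f (tgt b, j))
        + ∑ b ∈ univ.filter (fun b => src b = x), c b ^ 2 * f (tgt b, i) := by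
    rw [← Finset.sum_add_distrib, ← Finset.sum_neg_distrib, ← Finset.sum_add_distrib]
    exact Finset.sum_congr rfl fun b hb => (src_bond_identity src tgt c Rm hRm f x i b (Finset.mem_filter.mp hb).2).symm
  linarith [hT, hS]

/-! ## §3 The fibre-norm bound -/

/-- **`‖(R_bᵀ − 1)v‖ ≤ ε_b‖v‖` from `‖(R_b − 1)v‖ ≤ ε_b‖v‖`** (one deviation bound serves both actions: `(Rᵀ − 1)v = −Rᵀ(R − 1)v` and `Rᵀ` is
an isometry). [folklore] -/
theorem normT_sub_delta_le (R : Cp → Cp → ℝ) (hR : ∀ i j, ∑ k, R k i * R k j = if i = j then (1 : ℝ) else 0) {ε : ℝ}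
    (hε : ∀ v : Cp → ℝ, Real.sqrt (∑ i, (∑ j, (R i j - if i = j then (1 : ℝ) else 0) * v j) ^ 2) ≤ ε * Real.sqrt (∑ j, v j ^ 2))
    (v : Cp → ℝ) :
    Real.sqrt (∑ i, (∑ k, (R k i - if k = i then (1 : ℝ) else 0) * v k) ^ 2) ≤ ε * Real.sqrt (∑ k, v k ^ 2) := by
  have h : ∀ i, (∑ k, (R k i - if k = i then (1 : ℝ) else 0) * v k) ^ 2 =
      (∑ k, R k i * ∑ j, (R k j - if k = j then (1 : ℝ) else 0) * v j) ^ 2 := fun i => by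
    rw [sumT_sub_delta_eq_neg R hR v i, neg_sq]
  simp only [h]
  rw [sqrt_sum_sq_RmT R hR (fun k => ∑ j, (R k j - if k = j then (1 : ℝ) else 0) * v j)]
  exact hε v

/-- **THE FIBRE-NORM BOUND ON `(D_R*D_R − D_1*D_1)f`.**  Column-orthonormal `Rm`, flat `Rm₀ ≡ δ`; deviation bounds `‖(R_b − 1)v‖ ≤ ε_b‖v‖`
for every bond and a flux bound `‖M_R(x)v‖ ≤ ε_M‖v‖` at the site `x`.  Then
`‖(D_R*D_R f − D_1*D_1 f)(x,·)‖ ≤ Σ_{b : tgt b = x} |c_b|ε_b‖(D_R f)(b,·)‖ + Σ_{b : src b = x} |c_b|ε_b‖(D_R f)(b,·)‖ + ε_M‖f(x,·)‖`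
(§2 + Minkowski + `normT_sub_delta_le`). [cite: Balaban1985BackgroundPropagators, (3.35) p.396] [folklore] -/
theorem norm_covLap_sub_flat_le (hRm : ∀ b i j, ∑ k, Rm b k i * Rm b k j = if i = j then (1 : ℝ) else 0)
    (hflat : ∀ b i j, Rm₀ b i j = if i = j then (1 : ℝ) else 0) (ε : Bd → ℝ)
    (hε : ∀ b (v : Cp → ℝ), Real.sqrt (∑ i, (∑ j, (Rm b i j - if i = j then (1 : ℝ) else 0) * v j) ^ 2) ≤ ε b * Real.sqrt (∑ j, v j ^ 2))
    (f : St × Cp → ℝ) (x : St) {εM : ℝ}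
    (hM : ∀ v : Cp → ℝ, Real.sqrt (∑ i, ((∑ b ∈ univ.filter (fun b => tgt b = x), c b ^ 2 * ∑ j, (Rm b i j - if i = j then (1 : ℝ) else 0) * v j)
        + ∑ b ∈ univ.filter (fun b => src b = x), c b ^ 2 * ∑ k, (Rm b k i - if k = i then (1 : ℝ) else 0) * v k) ^ 2) ≤
        εM * Real.sqrt (∑ i, v i ^ 2)) :
    Real.sqrt (∑ i, (covDT src tgt c Rm (covD src tgt c Rm f) (x, i) - covDT src tgt c Rm₀ (covD src tgt c Rm₀ f) (x, i)) ^ 2) ≤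
      ∑ b ∈ univ.filter (fun b => tgt b = x), |c b| * ε b * Real.sqrt (∑ k, covD src tgt c Rm f (b, k) ^ 2)
        + ∑ b ∈ univ.filter (fun b => src b = x), |c b| * ε b * Real.sqrt (∑ k, covD src tgt c Rm f (b, k) ^ 2)
        + εM * Real.sqrt (∑ i, f (x, i) ^ 2) := by
  classical
  -- abbreviations for the three pieces, componentwise
  set A : Cp → ℝ := fun i => ∑ b ∈ univ.filter (fun b => tgt b = x),
    c b * ∑ k, (Rm b k i - if k = i then (1 : ℝ) else 0) * covD src tgt c Rm f (b, k) with hA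
  set B : Cp → ℝ := fun i => ∑ b ∈ univ.filter (fun b => src b = x),
    c b * ∑ k, (Rm b k i - if k = i then (1 : ℝ) else 0) * covD src tgt c Rm f (b, k) with hB
  set C : Cp → ℝ := fun i => (∑ b ∈ univ.filter (fun b => tgt b = x), c b ^ 2 * ∑ j, (Rm b i j - if i = j then (1 : ℝ) else 0) * f (x, j))
    + ∑ b ∈ univ.filter (fun b => src b = x), c b ^ 2 * ∑ k, (Rm b k i - if k = i then (1 : ℝ) else 0) * f (x, k) with hC
  have hdiff : ∀ i, covDT src tgt c Rm (covD src tgt c Rm f) (x, i) - covDT src tgt c Rm₀ (covD src tgt c Rm₀ f) (x, i) =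
      (A i + B i) + C i := by
    intro i
    rw [covLap_flat_split src tgt c Rm Rm₀ hRm hflat f x i]
    simp only [hA, hB, hC]
    ring
  simp only [hdiff]
  -- the first-order pieces, bond by bond
  have hAle : Real.sqrt (∑ i, A i ^ 2) ≤
      ∑ b ∈ univ.filter (fun b => tgt b = x), |c b| * ε b * Real.sqrt (∑ k, covD src tgt c Rm f (b, k) ^ 2) := by
    have h1 := sqrt_sum_sq_sum_le (univ.filter fun b => tgt b = x)
      (fun b i => c b * ∑ k, (Rm b k i - if k = i then (1 : ℝ) else 0) * covD src tgt c Rm f (b, k))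
    refine h1.trans (Finset.sum_le_sum fun b _ => ?_)
    rw [sqrt_sum_sq_smul, mul_assoc]
    exact mul_le_mul_of_nonneg_left (normT_sub_delta_le (Rm b) (hRm b) (hε b) (fun k => covD src tgt c Rm f (b, k))) (abs_nonneg _)
  have hBle : Real.sqrt (∑ i, B i ^ 2) ≤
      ∑ b ∈ univ.filter (fun b => src b = x), |c b| * ε b * Real.sqrt (∑ k, covD src tgt c Rm f (b, k) ^ 2) := by
    have h1 := sqrt_sum_sq_sum_le (univ.filter fun b => src b = x)
      (fun b i => c b * ∑ k, (Rm b k i - if k = i then (1 : ℝ) else 0) * covD src tgt c Rm f (b, k))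
    refine h1.trans (Finset.sum_le_sum fun b _ => ?_)
    rw [sqrt_sum_sq_smul, mul_assoc]
    exact mul_le_mul_of_nonneg_left (normT_sub_delta_le (Rm b) (hRm b) (hε b) (fun k => covD src tgt c Rm f (b, k))) (abs_nonneg _)
  have hCle : Real.sqrt (∑ i, C i ^ 2) ≤ εM * Real.sqrt (∑ i, f (x, i) ^ 2) := hM (fun i => f (x, i))
  calc Real.sqrt (∑ i, ((A i + B i) + C i) ^ 2)
      ≤ Real.sqrt (∑ i, (A i + B i) ^ 2) + Real.sqrt (∑ i, C i ^ 2) := sqrt_sum_sq_add_le _ _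
    _ ≤ (Real.sqrt (∑ i, A i ^ 2) + Real.sqrt (∑ i, B i ^ 2)) + Real.sqrt (∑ i, C i ^ 2) :=
        add_le_add (sqrt_sum_sq_add_le _ _) le_rfl
    _ ≤ _ := add_le_add (add_le_add hAle hBle) hCle

end Split

end

end Summit.QuantumFields.BalabanUV.Beta.CovariantLaplacianFlatSplit
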